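import Mathlib
import Literature.Computability.Complexity.CliqueTestGraphs
import Summits.PneNP.PneNP.Theorems.ConvexRankGatesConvexGateBlindJuntaBlind

/-!
# PneNP / ConvexRankGates — `ConvexGateBlind`: junta certificates are blind up to the SHARP locality `k - 1`

Helpers (`--supports stmt-PneNP-10680`). `…JuntaBlind.lean` proved that for a balanced `K`-colouring column
(`K ≥ 2` classes of size `n ≥ K+1`, `k = K+1`) no identity `cdist Q (colorVec h) - ε = ∑_l F_l(Q ∩ S_l)`, `F_l ≥ 0`,
holds on the `k`-sets as long as `2 #S_l ≤ K` — half the trivial threshold: with `#S_l = k` the atoms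
`(cdist Q₀ - ε) 𝟙[Q = Q₀]` do represent the column. THIS FILE closes the gap: the theorem holds for ALL `#S_l ≤ K = k-1`
(`cdist_colorVec_not_juntaRep_sharp`, registered stub `junta_blind_sharp`), i.e. EVERY term of a local LP certificate
must read all `k` vertices of some `k`-set — the locality threshold is exactly `k`.

The new ingredient is a sharp lower bound for the rainbow sums `R_A(x) = ∑_{L ⊆ A rainbow} (-1)^{#L} n^{-#L}/(x-#L)` of
`…RainbowSums.lean`: `R_A(N) ≥ 1/N - #A/(n(N-1))` whenever `#A + 1 ≤ N` and `#A ≤ n` (`rbSum_sharp_lower`; the old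
`rbSum_bounds` needed `#A + 2 ≤ N`, `2#A ≤ n`). Proof: group the sum by `j = #L` — `R_A(N) = ∑_j (-1)^j r_j/(N-j)` with
`r_j = N_j/n^j`, `N_j` the number of rainbow `j`-subsets of `A` (`rbSum_eq_sum_rbCount`) — and pair consecutive terms:
double counting gives `(j+1) N_{j+1} ≤ #A · N_j ≤ n N_j` (`succ_mul_rbCount_le`), so `r_{2i+1} ≤ r_{2i}/(2i+1)` and
`r_{2i}/(N-2i) - r_{2i+1}/(N-2i-1) ≥ 0` because `(2i+1)(N-2i-1) ≥ N-2i` for `N ≥ 2i+2`. Hence every local law of the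
rainbow pseudo-distribution at level `≤ K` is non-negative (`rbL_localLaw_nonneg_sharp`), and the junta theorem follows
verbatim. (Numerically the level is exact: at level `k` the atoms exist, and for `n = k` the level-`K` law of a full class
already fails.) [new]
-/

set_option linter.dupNamespace false

namespace Summit.PneNP.PneNP.Theorems

open Finset Literature.Computability.Complexity
open Summit.PneNP.PneNP.Cruxes.ConvexGateBlind.StrictRankConicCover (cdist)

noncomputable section

section rainbow

variable {α κ : Type*} [DecidableEq α] [DecidableEq κ]

omit [DecidableEq α] in
open Classical in
/-- `N_j = 0` for `j > #A`. -/
theorem rbCount_eq_zero_of_lt (h : α → κ) (A : Finset α) {j : ℕ} (hj : A.card < j) :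
    ((A.powersetCard j).filter fun L : Finset α => Set.InjOn h (L : Set α)).card = 0 := by
  rw [Finset.powersetCard_eq_empty.2 hj, Finset.filter_empty, Finset.card_empty]

omit [DecidableEq α] in
open Classical in
/-- **Grouping the rainbow sum by cardinality**: `R_A(x) = ∑_{j ≤ #A} (-1)^j n^{-j}/(x-j) · N_j`. -/
theorem rbSum_eq_sum_rbCount (h : α → κ) (n : ℝ) (A : Finset α) (x : ℝ) :
    rbSum h n A x = ∑ j ∈ range (A.card + 1),
      (-1 : ℝ) ^ j * (n⁻¹) ^ j / (x - j) * ((A.powersetCard j).filter fun L : Finset α => Set.InjOn h (L : Set α)).card := by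
  unfold rbSum
  rw [Finset.powerset_card_disjiUnion, Finset.sum_disjiUnion]
  refine Finset.sum_congr rfl fun j _ => ?_
  have hcongr : ∀ L ∈ A.powersetCard j,
      (if Set.InjOn h (L : Set α) then (-1 : ℝ) ^ L.card * (n⁻¹) ^ L.card / (x - L.card) else 0) =
        if Set.InjOn h (L : Set α) then (-1 : ℝ) ^ j * (n⁻¹) ^ j / (x - j) else 0 := by
    intro L hL
    rw [(Finset.mem_powersetCard.1 hL).2]
  rw [Finset.sum_congr rfl hcongr, ← Finset.sum_filter, Finset.sum_const, nsmul_eq_mul]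
  ring

open Classical in
/-- **Double counting**: `(j+1) N_{j+1} ≤ #A · N_j` — a rainbow `(j+1)`-set has `j+1` rainbow `j`-subsets, and a rainbow
`j`-set has at most `#A` rainbow one-point extensions inside `A`. -/
theorem succ_mul_rbCount_le (h : α → κ) (A : Finset α) (j : ℕ) :
    (j + 1) * ((A.powersetCard (j + 1)).filter fun L : Finset α => Set.InjOn h (L : Set α)).card ≤
      A.card * ((A.powersetCard j).filter fun L : Finset α => Set.InjOn h (L : Set α)).card := by
  set s := (A.powersetCard (j + 1)).filter fun L : Finset α => Set.InjOn h (L : Set α) with hs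
  set t := (A.powersetCard j).filter fun L : Finset α => Set.InjOn h (L : Set α) with ht
  have key := Finset.card_mul_le_card_mul (s := s) (t := t) (fun L' L => L ⊆ L') (m := j + 1) (n := A.card)
    (fun L' hL' => ?_) (fun L hL => ?_)
  · simpa [hs, ht, mul_comm] using key
  · -- `j + 1 ≤ #{L ∈ t | L ⊆ L'}`: the sets `L'.erase v`, `v ∈ L'`
    rw [hs, mem_filter, mem_powersetCard] at hL'
    obtain ⟨⟨hL'A, hL'card⟩, hL'inj⟩ := hL'
    rw [← hL'card]
    refine Finset.card_le_card_of_injOn (fun v => L'.erase v) (fun v hv => ?_) (fun v hv w hw hvw => ?_)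
    · rw [Finset.mem_coe, Finset.mem_bipartiteAbove, ht, mem_filter, mem_powersetCard]
      have hv' : v ∈ L' := hv
      refine ⟨⟨⟨(erase_subset v L').trans hL'A, ?_⟩, hL'inj.mono (by exact_mod_cast erase_subset v L')⟩,
        erase_subset v L'⟩
      rw [card_erase_of_mem hv', hL'card, Nat.add_sub_cancel]
    · -- `L'.erase v = L'.erase w → v = w`
      have hvw' : L'.erase v = L'.erase w := hvw
      have hv' : v ∈ L' := hv
      by_contra hne
      have : v ∈ L'.erase w := mem_erase.2 ⟨hne, hv'⟩
      rw [← hvw'] at this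
      exact (mem_erase.1 this).1 rfl
  · -- `#{L' ∈ s | L ⊆ L'} ≤ #A`: every such `L'` is `insert v L` with `v ∈ A`
    refine le_trans (Finset.card_le_card (t := A.image fun v => insert v L) fun L' hL' => ?_) Finset.card_image_le
    rw [Finset.mem_bipartiteBelow, hs, mem_filter, mem_powersetCard] at hL'
    obtain ⟨⟨⟨hL'A, hL'card⟩, -⟩, hLL'⟩ := hL'
    rw [ht, mem_filter, mem_powersetCard] at hL
    obtain ⟨⟨-, hLcard⟩, -⟩ := hL
    have hdiff : (L' \ L).card = 1 := by rw [card_sdiff_of_subset hLL', hL'card, hLcard]; omega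
    obtain ⟨v, hv⟩ := Finset.card_eq_one.1 hdiff
    have hvmem : v ∈ L' \ L := by rw [hv]; exact mem_singleton_self v
    refine mem_image.2 ⟨v, hL'A (mem_sdiff.1 hvmem).1, ?_⟩
    -- `insert v L = L'`
    have hsub : insert v L ⊆ L' := insert_subset (mem_sdiff.1 hvmem).1 hLL'
    refine eq_of_subset_of_card_le hsub ?_
    rw [card_insert_of_notMem (mem_sdiff.1 hvmem).2, hLcard, hL'card]

/-- Pairs of consecutive terms with non-negative sums add up to a non-negative total. -/
theorem sum_Ico_two_nonneg_of_pairs (c : ℕ → ℝ) (M : ℕ) (hc : ∀ i, 1 ≤ i → i ≤ M → 0 ≤ c (2 * i) + c (2 * i + 1)) :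
    0 ≤ ∑ j ∈ Ico 2 (2 * M + 2), c j := by
  induction M with
  | zero => simp
  | succ M ih =>
    have h1 : 2 ≤ 2 * M + 2 := by omega
    rw [show 2 * (M + 1) + 2 = (2 * M + 2 + 1) + 1 by ring, Finset.sum_Ico_succ_top (by omega),
      Finset.sum_Ico_succ_top h1]
    have hpair := hc (M + 1) (by omega) le_rfl
    rw [show 2 * (M + 1) = 2 * M + 2 by ring] at hpair
    have := ih (fun i hi hiM => hc i hi (by omega))
    linarith

open Classical in
/-- **Sharp lower bound for the rainbow sums.** If `#A + 1 ≤ N` and `#A ≤ n` (`0 < n`), then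
`1/N - #A/(n(N-1)) ≤ R_A(N)`. (The bound of `rbSum_bounds` under the weaker hypotheses that are actually needed.) [new] -/
theorem rbSum_sharp_lower (h : α → κ) {n : ℝ} (hn : 0 < n) (A : Finset α) (N : ℕ) (hAN : A.card + 1 ≤ N)
    (hAn : (A.card : ℝ) ≤ n) :
    1 / (N : ℝ) - A.card / (n * ((N : ℝ) - 1)) ≤ rbSum h n A N := by
  set c : ℕ → ℝ := fun j => (-1 : ℝ) ^ j * (n⁻¹) ^ j / ((N : ℝ) - j) *
    ((A.powersetCard j).filter fun L : Finset α => Set.InjOn h (L : Set α)).card with hc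
  have hsum : rbSum h n A N = ∑ j ∈ range (A.card + 1), c j := rbSum_eq_sum_rbCount h n A N
  -- the terms `j = 0, 1`
  have hc0 : c 0 = 1 / (N : ℝ) := by
    simp only [hc, pow_zero, Nat.cast_zero, sub_zero, one_mul]
    rw [Finset.powersetCard_zero, Finset.filter_singleton, if_pos (by simp [Set.InjOn])]
    simp
  have hc1 : c 1 = -(A.card / (n * ((N : ℝ) - 1))) := by
    simp only [hc, pow_one, Nat.cast_one]
    have hall : ((A.powersetCard 1).filter fun L : Finset α => Set.InjOn h (L : Set α)) = A.powersetCard 1 := by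
      refine Finset.filter_true_of_mem fun L hL => ?_
      rw [mem_powersetCard] at hL
      obtain ⟨a, rfl⟩ := Finset.card_eq_one.1 hL.2
      simp [Set.InjOn]
    rw [hall, Finset.card_powersetCard, Nat.choose_one_right]
    field_simp
  -- the terms beyond `#A` vanish
  have hcz : ∀ j, A.card < j → c j = 0 := fun j hj => by
    simp only [hc, rbCount_eq_zero_of_lt h A hj, Nat.cast_zero, mul_zero]
  -- consecutive pairs from `j = 2` on are non-negative
  have hNA : (A.card : ℝ) + 1 ≤ N := by exact_mod_cast hAN
  have hpair : ∀ i, 1 ≤ i → 0 ≤ c (2 * i) + c (2 * i + 1) := by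
    intro i hi
    have hev : (-1 : ℝ) ^ (2 * i) = 1 := by rw [pow_mul]; simp
    have hodd : (-1 : ℝ) ^ (2 * i + 1) = -1 := by rw [pow_succ, hev]; simp
    by_cases h2i : A.card < 2 * i
    · rw [hcz _ h2i, hcz _ (by omega)]; simp
    push Not at h2i
    -- `r_{2i}/(N-2i) ≥ 0`
    have h2iR : ((2 * i : ℕ) : ℝ) = 2 * (i : ℝ) := by push_cast; ring
    have h2i1R : ((2 * i + 1 : ℕ) : ℝ) = 2 * (i : ℝ) + 1 := by push_cast; ring
    have hden : (0 : ℝ) < (N : ℝ) - 2 * i := by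
      have : ((2 * i : ℕ) : ℝ) ≤ A.card := by exact_mod_cast h2i
      rw [h2iR] at this
      linarith
    have hr : (0 : ℝ) ≤ (n⁻¹) ^ (2 * i) * ((A.powersetCard (2 * i)).filter fun L : Finset α => Set.InjOn h (L : Set α)).card := by positivity
    have hc2i : c (2 * i) = (n⁻¹) ^ (2 * i) * ((A.powersetCard (2 * i)).filter fun L : Finset α => Set.InjOn h (L : Set α)).card / ((N : ℝ) - 2 * i) := by
      simp only [hc, hev, one_mul]
      rw [h2iR]
      ring
    by_cases h2i1 : A.card < 2 * i + 1
    · rw [hcz _ h2i1, add_zero, hc2i]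
      exact div_nonneg hr hden.le
    push Not at h2i1
    have hden1 : (0 : ℝ) < (N : ℝ) - 2 * i - 1 := by
      have : ((2 * i + 1 : ℕ) : ℝ) ≤ A.card := by exact_mod_cast h2i1
      rw [h2i1R] at this
      linarith
    -- double counting: `(2i+1) N_{2i+1} ≤ #A N_{2i} ≤ n N_{2i}`
    have hdc : ((2 * i + 1 : ℕ) : ℝ) * ((A.powersetCard (2 * i + 1)).filter fun L : Finset α => Set.InjOn h (L : Set α)).card ≤ n * ((A.powersetCard (2 * i)).filter fun L : Finset α => Set.InjOn h (L : Set α)).card := by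
      have h1 : ((2 * i + 1) * ((A.powersetCard (2 * i + 1)).filter fun L : Finset α => Set.InjOn h (L : Set α)).card : ℕ) ≤ A.card * ((A.powersetCard (2 * i)).filter fun L : Finset α => Set.InjOn h (L : Set α)).card :=
        succ_mul_rbCount_le h A (2 * i)
      have h2 : (((2 * i + 1) * ((A.powersetCard (2 * i + 1)).filter fun L : Finset α => Set.InjOn h (L : Set α)).card : ℕ) : ℝ) ≤ ((A.card * ((A.powersetCard (2 * i)).filter fun L : Finset α => Set.InjOn h (L : Set α)).card : ℕ) : ℝ) := by
        exact_mod_cast h1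
      push_cast at h2
      have h3 : (A.card : ℝ) * ((A.powersetCard (2 * i)).filter fun L : Finset α => Set.InjOn h (L : Set α)).card ≤ n * ((A.powersetCard (2 * i)).filter fun L : Finset α => Set.InjOn h (L : Set α)).card :=
        mul_le_mul_of_nonneg_right hAn (Nat.cast_nonneg _)
      have h4 : ((2 * i + 1 : ℕ) : ℝ) = 2 * (i : ℝ) + 1 := by push_cast; ring
      rw [h4]; linarith
    have hc2i1 : c (2 * i + 1) = -((n⁻¹) ^ (2 * i + 1) * ((A.powersetCard (2 * i + 1)).filter fun L : Finset α => Set.InjOn h (L : Set α)).card / ((N : ℝ) - 2 * i - 1)) := by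
      simp only [hc, hodd]
      rw [h2i1R]
      ring
    rw [hc2i, hc2i1]
    -- reduce to the arithmetic inequality
    set r0 : ℝ := (n⁻¹) ^ (2 * i) * ((A.powersetCard (2 * i)).filter fun L : Finset α => Set.InjOn h (L : Set α)).card with hr0
    have hr1 : (n⁻¹) ^ (2 * i + 1) * ((A.powersetCard (2 * i + 1)).filter fun L : Finset α => Set.InjOn h (L : Set α)).card ≤ r0 / (2 * (i : ℝ) + 1) := by
      rw [hr0, le_div_iff₀ (by positivity), pow_succ]
      rw [← h2i1R]
      calc (n⁻¹) ^ (2 * i) * n⁻¹ * ↑(((A.powersetCard (2 * i + 1)).filter fun L : Finset α => Set.InjOn h (L : Set α)).card) * ((2 * i + 1 : ℕ) : ℝ)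
          = (n⁻¹) ^ (2 * i) * n⁻¹ * (((2 * i + 1 : ℕ) : ℝ) * ((A.powersetCard (2 * i + 1)).filter fun L : Finset α => Set.InjOn h (L : Set α)).card) := by ring
        _ ≤ (n⁻¹) ^ (2 * i) * n⁻¹ * (n * ((A.powersetCard (2 * i)).filter fun L : Finset α => Set.InjOn h (L : Set α)).card) :=
            mul_le_mul_of_nonneg_left hdc (by positivity)
        _ = (n⁻¹) ^ (2 * i) * ((A.powersetCard (2 * i)).filter fun L : Finset α => Set.InjOn h (L : Set α)).card := by field_simp
    -- `r0/(N-2i) - r1/(N-2i-1) ≥ r0 [1/(N-2i) - 1/((2i+1)(N-2i-1))] ≥ 0`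
    have hi1 : (1 : ℝ) ≤ i := by exact_mod_cast hi
    have hN2 : (2 : ℝ) * i + 2 ≤ N := by
      have : ((2 * i + 1 : ℕ) : ℝ) ≤ A.card := by exact_mod_cast h2i1
      rw [h2i1R] at this
      linarith
    have harith : (N : ℝ) - 2 * i ≤ (2 * (i : ℝ) + 1) * ((N : ℝ) - 2 * i - 1) := by nlinarith
    have hr0nn : 0 ≤ r0 := hr
    have step : (n⁻¹) ^ (2 * i + 1) * ((A.powersetCard (2 * i + 1)).filter fun L : Finset α => Set.InjOn h (L : Set α)).card / ((N : ℝ) - 2 * i - 1) ≤ r0 / ((N : ℝ) - 2 * i) := by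
      calc (n⁻¹) ^ (2 * i + 1) * ((A.powersetCard (2 * i + 1)).filter fun L : Finset α => Set.InjOn h (L : Set α)).card / ((N : ℝ) - 2 * i - 1)
          ≤ (r0 / (2 * (i : ℝ) + 1)) / ((N : ℝ) - 2 * i - 1) := div_le_div_of_nonneg_right hr1 hden1.le
        _ = r0 / ((2 * (i : ℝ) + 1) * ((N : ℝ) - 2 * i - 1)) := by rw [div_div]
        _ ≤ r0 / ((N : ℝ) - 2 * i) := div_le_div_of_nonneg_left hr0nn hden harith
    linarith
  -- assemble: `R = c₀ + c₁ + ∑_{2 ≤ j ≤ #A} c_j ≥ c₀ + c₁`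
  have hsplit : ∑ j ∈ range (A.card + 1), c j = c 0 + c 1 + ∑ j ∈ Ico 2 (2 * A.card + 2), c j := by
    have hext : ∑ j ∈ range (A.card + 1), c j = ∑ j ∈ range (2 * A.card + 2), c j := by
      refine Finset.sum_subset (fun j hj => ?_) (fun j hj hj' => hcz j ?_)
      · rw [mem_range] at hj ⊢; omega
      · rw [mem_range] at hj hj'; omega
    rw [hext, Finset.range_eq_Ico]
    rw [← Finset.sum_Ico_consecutive c (show 0 ≤ 2 by norm_num) (show 2 ≤ 2 * A.card + 2 by omega),
      ← Finset.range_eq_Ico]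
    simp [Finset.sum_range_succ]
  have htail := sum_Ico_two_nonneg_of_pairs c A.card (fun i hi _ => hpair i hi)
  rw [hsum, hsplit, hc0, hc1]
  linarith

/-- **Sharp non-negativity of the rainbow sums**: `0 ≤ R_A(N)` whenever `#A + 1 ≤ N ≤ n`. [new] -/
theorem rbSum_nonneg_sharp (h : α → κ) {n : ℝ} (hn : 0 < n) (A : Finset α) (N : ℕ) (hAN : A.card + 1 ≤ N)
    (hNn : (N : ℝ) ≤ n) : 0 ≤ rbSum h n A N := by
  have hAN' : (A.card : ℝ) + 1 ≤ N := by exact_mod_cast hAN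
  have hAn : (A.card : ℝ) ≤ n := by linarith
  refine le_trans ?_ (rbSum_sharp_lower h hn A N hAN hAn)
  have hA0 : (0 : ℝ) ≤ A.card := Nat.cast_nonneg _
  have hN0 : (0 : ℝ) < N := by linarith
  by_cases hA : A.card = 0
  · rw [hA, Nat.cast_zero, zero_div, sub_zero]
    positivity
  · have hA1 : (1 : ℝ) ≤ A.card := by exact_mod_cast Nat.one_le_iff_ne_zero.2 hA
    have hN1 : (0 : ℝ) < (N : ℝ) - 1 := by linarith
    rw [sub_nonneg, div_le_div_iff₀ (by positivity) hN0, one_mul]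
    nlinarith

end rainbow

/-! ## Local laws up to level `K` and the sharp junta theorem -/

variable {m K : ℕ}

/-- **Every local law of the rainbow pseudo-distribution at level `≤ K` is non-negative** (`K ≥ 2` classes of size
`n ≥ K+1`): `μ_S(P) = L(𝟙[Q ∩ S = P]) ≥ 0` for all `P ⊆ S`, `#S ≤ K`. (`rbL_localLaw_nonneg` had `2 #S ≤ K`.) [new] -/
theorem rbL_localLaw_nonneg_sharp (h : Fin m → Fin K) {n t : ℕ} (hn : ∀ c, (cls h c).card = n) (hK : 2 ≤ K)
    (hKn : K + 1 ≤ n) (ht : t ≤ K) {S P : Finset (Fin m)} (hPS : P ⊆ S) (hS : S.card ≤ t) :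
    0 ≤ rbL h n (fun Q => if Q ∩ S = P then 1 else 0) := by
  classical
  rw [rbL_localLaw h hn hKn hPS (by omega)]
  split_ifs with hP
  · refine mul_nonneg (by positivity) ?_
    set A := (S \ P).filter fun v => h v ∉ P.image h with hA
    have hAcard : A.card + P.card ≤ t := by
      have h1 : A.card ≤ (S \ P).card := card_filter_le _ _
      rw [card_sdiff_of_subset hPS] at h1
      have h2 := card_le_card hPS
      omega
    have hnpos : (0 : ℝ) < n := by
      have : 0 < n := by omega
      positivity
    have hPK : P.card ≤ K := by have := card_le_card hPS; omega
    have hcast : (K : ℝ) + 1 - P.card = ((K + 1 - P.card : ℕ) : ℝ) := by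
      rw [Nat.cast_sub (by omega)]; push_cast; ring
    rw [hcast]
    refine rbSum_nonneg_sharp h hnpos A (K + 1 - P.card) (by omega) ?_
    have : ((K + 1 - P.card : ℕ) : ℝ) ≤ ((K + 1 : ℕ) : ℝ) := by exact_mod_cast Nat.sub_le _ _
    have h2 : ((K + 1 : ℕ) : ℝ) ≤ n := by exact_mod_cast hKn
    linarith
  · exact le_refl _

/-- **Junta certificates are ε-exactly blind up to the sharp locality `k - 1`.** For a balanced colouring `h` with `K ≥ 2`
classes of size `n ≥ K+1` and every `ε > 0`: there is no representation `cdist Q (colorVec h) - ε = ∑_l F_l(Q ∩ S_l)` on the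
`(K+1)`-sets with `F_l ≥ 0` and `#S_l ≤ K` — whatever the number of terms. With `#S_l = K + 1` the atoms do represent
the column, so the locality threshold is exactly `k = K + 1`. [new] -/
theorem cdist_colorVec_not_juntaRep_sharp (h : Fin m → Fin K) {n t : ℕ} (hn : ∀ c, (cls h c).card = n) (hK : 2 ≤ K)
    (hKn : K + 1 ≤ n) (ht : t ≤ K) {ε : ℝ} (hε : 0 < ε) {ι : Type*} [Fintype ι] (S : ι → Finset (Fin m))
    (F : ι → Finset (Fin m) → ℝ) (hS : ∀ l, (S l).card ≤ t) (hF : ∀ l P, 0 ≤ F l P) :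
    ¬ ∀ Q : Finset (Fin m), Q.card = K + 1 → cdist Q (colorVec h) - ε = ∑ l, F l (Q ∩ S l) := by
  classical
  intro hrep
  have hL := rbL_congr h n hrep
  have hleft : rbL h n (fun Q => cdist Q (colorVec h) - ε) = -(ε * ((K : ℝ) * (n : ℝ) ^ K / ((K : ℝ) + 1))) := by
    rw [rbL_sub, rbL_cdist_colorVec h hn hK hKn, zero_sub]
    rw [rbL_congr_fun h n (f := fun _ => ε) (f' := fun Q => ε * 1) (fun Q => by ring), rbL_smul, rbL_one h hn hKn]
  have hneg : rbL h n (fun Q => cdist Q (colorVec h) - ε) < 0 := by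
    rw [hleft, neg_lt_zero]
    have hKpos : (0 : ℝ) < K := by exact_mod_cast (show 0 < K by omega)
    have hnpos : (0 : ℝ) < n := by exact_mod_cast (show 0 < n by omega)
    positivity
  have hright : 0 ≤ rbL h n (fun Q => ∑ l, F l (Q ∩ S l)) := by
    rw [rbL_sum]
    refine Finset.sum_nonneg fun l _ => ?_
    have hexp : ∀ Q : Finset (Fin m), F l (Q ∩ S l) =
        ∑ P ∈ (S l).powerset, F l P * (if Q ∩ S l = P then (1 : ℝ) else 0) := by
      intro Q
      rw [Finset.sum_eq_single_of_mem (Q ∩ S l) (mem_powerset.2 inter_subset_right)]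
      · simp
      · intro P _ hP
        rw [if_neg (Ne.symm hP), mul_zero]
    rw [rbL_congr_fun h n hexp, rbL_sum]
    refine Finset.sum_nonneg fun P hP => ?_
    rw [rbL_smul]
    exact mul_nonneg (hF l P) (rbL_localLaw_nonneg_sharp h hn hK hKn ht (mem_powerset.1 hP) (hS l))
  rw [hL] at hneg
  exact absurd hright (not_le.2 hneg)

/-- **Registered helper stub (junta LPs are blind up to locality `k - 1`).** Restatement of
`cdist_colorVec_not_juntaRep_sharp` with all parameters explicit. -/
theorem junta_blind_sharp : ∀ {m K n t : ℕ} (h : Fin m → Fin K), (∀ c, (cls h c).card = n) → 2 ≤ K → K + 1 ≤ n → t ≤ K → ∀ (ε : ℝ), 0 < ε → ∀ {ι : Type} [Fintype ι] (S : ι → Finset (Fin m)) (F : ι → Finset (Fin m) → ℝ), (∀ l, (S l).card ≤ t) → (∀ l P, 0 ≤ F l P) → ¬ ∀ Q : Finset (Fin m), Q.card = K + 1 → cdist Q (colorVec h) - ε = ∑ l, F l (Q ∩ S l) := by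
  intro m K n t h hn hK hKn ht ε hε ι _ S F hS hF
  exact cdist_colorVec_not_juntaRep_sharp h hn hK hKn ht hε S F hS hF

end

end Summit.PneNP.PneNP.Theorems
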